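import Summits.Ventures.Crystal3D.Bulk.GapReduction
import Mathlib.Topology.MetricSpace.ProperSpace
import Mathlib.Topology.Order.Compact
import HarnessLib

/-!
# GAP(h) by enumerate-and-kill: the glue skeleton (statements, named hypotheses) and the one
# analytic step proved now (an extremal counter-configuration exists)

HONEST FRAMING. Part of the venture `Summits/Ventures/Crystal3D` (cell `pub-crystal3d`, phase 2,
`PLAN.md` R42 — 24-hour decision sprint on GAP(h*), `h* = 1.26`; seat typer-bulk-2; coordinator
item (3) "typers land the GLUE skeleton: statements first, named hypotheses, no sorry"). Upstream
glue is in the tree: `GapTupleDiam h → KissingClassification (2h) → BulkCrystallization3D 702`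
(`Bulk/GapReductionSharp.lean`), the four GAP forms are equivalent (`Bulk/GapForms.lean`). THIS
file types the DOWNSTREAM glue — how a Musin–Tarasov-style certified enumerate-and-kill census
(cell files `phase2/ENV-CENSUS/DESIGN-L12-THEORY.md` §P-L6, `TARGET-GAP.md`) discharges
`GapTupleDiam h` — as a SCHEMA with NAMED HYPOTHESES, and proves the one purely analytic step:

* `IsGapConfig c` — an admissible fourteen-ball configuration (pairwise `≥ 1`, balls `1…12`
  touching ball `0`); `GapTupleDiam h ↔ ∀ c, IsGapConfig c → h ≤ dist (c 0) (c 13)`.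
* PROVED (`exists_isMinOn_intruder`): if some admissible configuration has its fourteenth ball
  within distance `h` of ball `0`, then an admissible configuration MINIMISING that distance exists
  (compactness of the normalised configuration space; the "extremal pair" of §P-L6/T0, on which
  the structural lemmas P-L1–P-L3 are stated). Hence `GapTupleDiam h` fails iff a most-intruding
  admissible configuration has intruder distance `< h` (`not_gapTupleDiam_iff_exists_min`).
* SCHEMA (`GapCensus`: a type of cells, a finite universe, a realisation semantics) with the
  three NAMED HYPOTHESES the cell's seats own: `GapCensus.Complete h` (theory: extremal reduction
  P-L1, local structure P-L2, faces P-L3/L, range cut P-L5′, and generator-class inclusion ⇒ every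
  most-intruding configuration with intruder distance `< h` realises a cell of the universe),
  `GapCensus.AllKilled` (engines A/B: every cell carries a checked kill certificate), and the
  composition `gapTupleDiam_of_census : S.Complete h → S.AllKilled → GapTupleDiam h`.

Nothing here is a claim about GAP(1.26): `Complete` and `AllKilled` are exactly what the sprint's
paper lemmas and certificates must supply; the schema only pins their Lean shapes.
-/

noncomputable section

open scoped BigOperators Topology
open Finset Filter

namespace Summit.Ventures.Crystal3D

/-! ## Admissible fourteen-ball configurations and the intruder distance -/

/-- An **admissible configuration** for the GAP problem (contact-distance-1 units): fourteen
centres pairwise at distance `≥ 1`, the balls `1, …, 12` touching ball `0`. (Ball `13` is the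
potential intruder; by `coordination_eq_twelve_of_tuple` it does not touch ball `0`.) -/
def IsGapConfig (c : Fin 14 → EuclideanSpace ℝ (Fin 3)) : Prop :=
  (∀ i j : Fin 14, i ≠ j → (1 : ℝ) ≤ dist (c i) (c j)) ∧
    ∀ i : Fin 14, i ≠ 0 → i ≠ 13 → dist (c i) (c 0) = 1

/-- The **intruder distance** of a configuration: `dist (c 0) (c 13)`. -/
def intruderDist (c : Fin 14 → EuclideanSpace ℝ (Fin 3)) : ℝ :=
  dist (c 0) (c 13)

/-- `GapTupleDiam h` says: every admissible configuration has intruder distance `≥ h`. -/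
theorem gapTupleDiam_iff_forall_isGapConfig (h : ℝ) :
    GapTupleDiam h ↔ ∀ c, IsGapConfig c → h ≤ intruderDist c :=
  ⟨fun hg c hc => hg c hc.1 hc.2, fun hg c h1 h2 => hg c ⟨h1, h2⟩⟩

/-- Admissibility is invariant under translation. -/
theorem IsGapConfig.sub_const {c : Fin 14 → EuclideanSpace ℝ (Fin 3)} (hc : IsGapConfig c)
    (v : EuclideanSpace ℝ (Fin 3)) : IsGapConfig fun i => c i - v :=
  ⟨fun i j hij => by rw [dist_sub_right]; exact hc.1 i j hij,
    fun i hi0 hi13 => by rw [dist_sub_right]; exact hc.2 i hi0 hi13⟩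

/-- The intruder distance is invariant under translation. -/
theorem intruderDist_sub_const (c : Fin 14 → EuclideanSpace ℝ (Fin 3))
    (v : EuclideanSpace ℝ (Fin 3)) : intruderDist (fun i => c i - v) = intruderDist c := by
  rw [intruderDist, intruderDist, dist_sub_right]

/-! ## The extremal configuration exists (compactness) -/

/-- The normalised search space: admissible configurations centred at the origin whose
intruder is within distance `h`. -/
def gapSpace (h : ℝ) : Set (Fin 14 → EuclideanSpace ℝ (Fin 3)) :=
  {c | c 0 = 0 ∧ IsGapConfig c ∧ intruderDist c ≤ h}

/-- The normalised search space is closed. -/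
theorem isClosed_gapSpace (h : ℝ) : IsClosed (gapSpace h) := by
  have hc : ∀ i : Fin 14, Continuous fun c : Fin 14 → EuclideanSpace ℝ (Fin 3) => c i :=
    fun i => continuous_apply i
  simp only [gapSpace, IsGapConfig, intruderDist, Set.setOf_and]
  refine (isClosed_eq (hc 0) continuous_const).inter ((IsClosed.inter ?_ ?_).inter ?_)
  · simp only [Set.setOf_forall]
    exact isClosed_iInter fun i => isClosed_iInter fun j => isClosed_iInter fun _ =>
      isClosed_le continuous_const ((hc i).dist (hc j))
  · simp only [Set.setOf_forall]
    exact isClosed_iInter fun i => isClosed_iInter fun _ => isClosed_iInter fun _ =>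
      isClosed_eq ((hc i).dist (hc 0)) continuous_const
  · exact isClosed_le ((hc 0).dist (hc 13)) continuous_const

/-- The normalised search space is bounded: every centre is within `max 1 h` of the origin. -/
theorem isBounded_gapSpace (h : ℝ) : Bornology.IsBounded (gapSpace h) := by
  refine (Metric.isBounded_iff_subset_closedBall (0 : Fin 14 → EuclideanSpace ℝ (Fin 3))).2
    ⟨max 1 h, fun c hc => ?_⟩
  obtain ⟨h0, hgap, hint⟩ := hc
  rw [Metric.mem_closedBall, dist_pi_le_iff (le_max_of_le_left zero_le_one)]
  intro i
  rw [Pi.zero_apply, ← h0]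
  by_cases hi0 : i = 0
  · rw [hi0, dist_self]; exact le_max_of_le_left zero_le_one
  by_cases hi13 : i = 13
  · rw [hi13, dist_comm]; exact le_max_of_le_right hint
  · rw [hgap.2 i hi0 hi13]; exact le_max_left _ _

/-- The normalised search space is compact. -/
theorem isCompact_gapSpace (h : ℝ) : IsCompact (gapSpace h) :=
  Metric.isCompact_of_isClosed_isBounded (isClosed_gapSpace h) (isBounded_gapSpace h)

/-- **An extremal (most-intruding) admissible configuration exists.** If some admissible
configuration has intruder distance `≤ h`, then some admissible configuration minimises the
intruder distance over ALL admissible configurations (and has intruder distance `≤ h`). This is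
the "extremal pair `ρ(X,p) = ρ*`" of the cell's DESIGN-L12-THEORY §T0 (maximal hole ⇔ minimal
intruder distance), on which the structural lemmas P-L1–P-L3 are stated; proved by compactness of
the normalised configuration space. -/
theorem exists_isMinOn_intruder {h : ℝ}
    (hne : ∃ c, IsGapConfig c ∧ intruderDist c ≤ h) :
    ∃ c, IsGapConfig c ∧ intruderDist c ≤ h ∧
      ∀ c', IsGapConfig c' → intruderDist c ≤ intruderDist c' := by
  obtain ⟨c₁, hc₁, hint₁⟩ := hne
  -- normalise: centre at the origin
  have hmem : (fun i => c₁ i - c₁ 0) ∈ gapSpace h :=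
    ⟨sub_self _, hc₁.sub_const _, by rw [intruderDist_sub_const]; exact hint₁⟩
  have hcont : ContinuousOn intruderDist (gapSpace h) :=
    (((continuous_apply 0).dist (continuous_apply 13)).continuousOn : _)
  obtain ⟨c, hc, hmin⟩ := (isCompact_gapSpace h).exists_isMinOn ⟨_, hmem⟩ hcont
  refine ⟨c, hc.2.1, hc.2.2, fun c' hc' => ?_⟩
  by_cases hle : intruderDist c' ≤ h
  · have hmem' : (fun i => c' i - c' 0) ∈ gapSpace h :=
      ⟨sub_self _, hc'.sub_const _, by rw [intruderDist_sub_const]; exact hle⟩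
    have := hmin hmem'
    rwa [Set.mem_setOf_eq, intruderDist_sub_const] at this
  · exact hc.2.2.trans (le_of_lt (not_le.1 hle))

/-- **GAP(h) fails iff a most-intruding admissible configuration intrudes below `h`.** So a
census may restrict itself to EXTREMAL configurations (and, by the structural lemmas it assumes,
to reduced extremal ones). -/
theorem not_gapTupleDiam_iff_exists_min (h : ℝ) :
    ¬ GapTupleDiam h ↔ ∃ c, IsGapConfig c ∧ intruderDist c < h ∧
      ∀ c', IsGapConfig c' → intruderDist c ≤ intruderDist c' := by
  rw [gapTupleDiam_iff_forall_isGapConfig]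
  constructor
  · intro hng
    push Not at hng
    obtain ⟨c₀, hc₀, hlt⟩ := hng
    obtain ⟨c, hc, -, hmin⟩ := exists_isMinOn_intruder ⟨c₀, hc₀, hlt.le⟩
    exact ⟨c, hc, (hmin c₀ hc₀).trans_lt hlt, hmin⟩
  · rintro ⟨c, hc, hlt, -⟩ hg
    exact absurd (hg c hc) (not_le.2 hlt)

/-! ## The census schema (named hypotheses) -/

/-- **An enumerate-and-kill census for GAP**: a type of cells (e.g. a tight contact map with a
`ρ`-interval and shape boxes), the finite enumerated universe (the generator's output), and the
realisation semantics (which configurations a cell accounts for). Both engine implementations of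
the sprint instantiate this with their own `Cell`/`Realizes`; the referee compares universes. -/
structure GapCensus where
  /-- the type of census cells -/
  Cell : Type
  /-- the enumerated universe -/
  univ : List Cell
  /-- `Realizes cell c`: the admissible configuration `c` is accounted for by `cell` -/
  Realizes : Cell → (Fin 14 → EuclideanSpace ℝ (Fin 3)) → Prop

namespace GapCensus

variable (S : GapCensus)

/-- **COMPLETENESS at `h`** (the PAPER side — owned by the theory seats: extremal reduction /
no-shift P-L1, local structure P-L2, planarity and faces P-L3 + Lemma L, range cut P-L5′, and the
inclusion of the admissible tight maps in the generator's class): every most-intruding admissible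
configuration with intruder distance `< h` realises some cell of the universe. NAMED HYPOTHESIS. -/
def Complete (h : ℝ) : Prop :=
  ∀ c, IsGapConfig c → intruderDist c < h →
    (∀ c', IsGapConfig c' → intruderDist c ≤ intruderDist c') → ∃ cell ∈ S.univ, S.Realizes cell c

/-- **ALL CELLS KILLED** (the MACHINE side — owned by the engine seats, two independent
implementations, certificates replayed by the referee): no cell of the universe is realised by an
admissible configuration. NAMED HYPOTHESIS (to be discharged cell by cell by checked certificates,
`decide`/`native_decide` over ℚ, as in the tree's `KissingSearch`). -/
def AllKilled : Prop :=
  ∀ cell ∈ S.univ, ∀ c, IsGapConfig c → ¬ S.Realizes cell c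

/-- **The glue: a complete, fully killed census proves GAP(h).** -/
theorem gapTupleDiam_of_census {h : ℝ} (hC : S.Complete h) (hK : S.AllKilled) :
    GapTupleDiam h := by
  by_contra hg
  obtain ⟨c, hc, hlt, hmin⟩ := (not_gapTupleDiam_iff_exists_min h).1 hg
  obtain ⟨cell, hcell, hreal⟩ := hC c hc hlt hmin
  exact hK cell hcell c hc hreal

/-- Completeness is ANTITONE in the target: a census complete at `h` is complete at every
`h' ≤ h` (fewer configurations to account for). -/
theorem Complete.anti {S : GapCensus} {h h' : ℝ} (hh : h' ≤ h) (hC : S.Complete h) :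
    S.Complete h' :=
  fun c hc hlt hmin => hC c hc (hlt.trans_le hh) hmin

/-- A census whose universe is EMPTY is complete at `h` only if GAP(h) holds outright — the
schema cannot be discharged vacuously on the machine side. -/
theorem gapTupleDiam_of_complete_nil {S : GapCensus} (hS : S.univ = []) {h : ℝ}
    (hC : S.Complete h) : GapTupleDiam h :=
  S.gapTupleDiam_of_census hC (by intro cell hcell; rw [hS] at hcell; simp at hcell)

end GapCensus

/-- **End to end (statements composed)**: a complete, fully killed GAP census at `h` together
with the classification at gap `2h` gives bulk crystallization with `K = 1296`
(`Bulk/GapReduction.lean`; `K = 702` via `Bulk/GapReductionSharp.lean`). At `h = 1.26` the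
classification is the tree's `Hales2012_kissingConfigCongruent`. -/
theorem bulkCrystallization3D_of_census_of_classification (S : GapCensus) {h : ℝ}
    (hC : S.Complete h) (hK : S.AllKilled) (hcl : KissingClassification (2 * h)) :
    BulkCrystallization3D 1296 :=
  bulkCrystallization3D_of_gapTupleDiam_of_classification (S.gapTupleDiam_of_census hC hK) hcl

end Summit.Ventures.Crystal3D

end
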